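import Summits.Schanuel.Schanuel.Theorems.RootDecomp1KThueMahler02

/-!
# RootDecomp1KThueMahler — lens 1, generation 56, NODE 16 «THUE–MAHLER ON THE LINE» (RULE K-R46 payable clause; CLAIM L2656, PRICE L2660) — continuation (RootDecomp1KThueMahler03): §7 the x-linear presentation toolkit and the territory certificates

(lens-1 g56 NODE 16 HOME kernel K = HOME/decomp-schanuel-lens-1/g56/ThueMahler.lean d10a59d7…, 957 l, 92 thm + 7 def, imports tree …RootDecomp1KIntegrality04 ONLY (no Literature import, no fact def, no private / set_option); Probe / Ctrl0 / Ctrl + NODE-g56.md + presearch_g56.txt + SHA256SUMS; CLAIM L2656, census LIVENESS-v5 node-16 rows L2657 (of record L2661 (A)), crit EX-ANTE PRICE L2660 (ONE THEOREM ×1 under K-R46's payable clause «an infinite class of AMENDED-FRONTIER pairs made unconditional by an input outside the toolkit of record» iff CHECKLIST K-g56; hand check of the Thue–Mahler mechanism SOUND), crit RULING L2661 (B) (L17P ERRATUM of record: `L17P = normShapeCurve (−(Y+3)) (Y²−17) 1 1` is LEVEL-FINITE hyp-free by node 10), NODE L2664, critic VERDICT L2665: CLEARED — THEOREM ×1 under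 K-R46's payable clause (EX-ANTE PRICE L2660), CHECKLIST K-g56 (1)–(10) MET; erratum §9 = ×0 bookkeeping as RULED L2661 (B); RULE K-R47 FIXED (toolkit of record ∪ {multi-form elimination at the odd places (`exists_resultant_bound`, two charts), archimedean floor (`exists_arch_floor`), product-formula transfer (`abs_mul_norm_le_of_odd_part`, `hform_eq_prod`), height-fed Ridout/Liouville closing}; FRONTIER re-amended by «NOT LEVEL-FINITE by the {2, ∞} Thue–Mahler reduction (XLinTM)»; open territory of record at m₀ = 2 := x-degree ≥ 2 members with |J_D| ≥ 2 or J_D = {j₀ ≥ 1} (M17P the standing witness) ∪ x-linear pairs outside XLinTM); PORT GO (K verbatim; docstrings/provenance only; «cite-token» spelling incl. «Mahler1933»; dedup 0) — census STAGING NOTE 6 L2667, crit ACK L2668 (staging sanctioned; identity-diff expectation identical 98 · MOD 3 · differ 0). Port by census-1 gen 22 as `RootDecomp1KThueMahler01–04` (`--supports stmt-Schanuel-33364`; no census credit): 01 = §1 COPRIMALITY (no common root, the two charts, the RESULTANT BOUND on common divisors of the binary forms) + §2 THE ODD PART (`|F|·‖F‖₂ ≤ |d₀|`) + §3 THE ARCHIMEDEAN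 FLOOR + §4 the bounded dyadic points `DyadicPt A B M r`, the integers `F_A`, `F_B` and the `2`-adic side; 02 = §5 THE THEOREM **`finite_dyadicPts`** (Thue–Mahler on the line: finitely many bounded dyadic points), **`levelFinite_xLinear_sep3 : LevelFinite (xLinP A B)`** and **`thinFibreAt_xLinear_sep3 : ThinFibreAt m₀ (xLinP A B)` for EVERY `m₀`** (B separable over ℚ, `3 ≤ deg B`, `deg A ≤ deg B`, `A ⊥ B`), the class predicate **`XLinTM P`**, `levelFinite_of_xLinTM` + §6 the odd-part lever by name `odd_dvd_resultant_of_onLevel` (Mahler 1933); 03 = §7 the x-linear presentation toolkit (`linC`, `xdeg_xLinP`, …) and the TERRITORY certificates by tree names; 04 = §8 the members **`L17C = (Y+3) + x(Y³−17)`**, **`E17C = (Y³+3) + x(Y³−17)`** and the infinite family **`LD17 D = (Y+3) + x(Y^D − 17)`, `D ≥ 3`** (`thinFibreAt_LD17` hyp-free, every `m₀`; `¬ DecidedAt 2`, `¬ LocalAt 2`, `¬ GaussAt`, `¬ HeightDecidedAt 2`, not of norm shape, `3 ≤ thinThreshold`) + §9 ERRATUM OF RECORD `L17P_eq_normShapeCurve`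 / `normShapeHyp_L17P` / `thinFibreAt_L17P_all` (hyp-free by node 10; ×0) + §10 sharpness and costume arithmetic. PORT EDITS: THREE one-line helpers PRIVATISED (file-local copies where used in a later part) — K's `isCoprime_num_den` (public twin `Literature.…SparseDyadicRationals.isCoprime_num_den` outside the import closure; private copies already in LevelFinite03/04/08/09), `isCoprime_two_pow_of_odd'` and `norm_intCast_Cp_le_one` (head dry-run dedup.foreign: print like BirchSwinnertonDyer decls) —; 30 one-line docstrings on undocumented computation lemmas of §7–§9 (statements quoted); otherwise none (no dedup.landed twin, no set_option, no cite-token in a def docstring); provenance doc blocks + continuation headers = K's own open-lines; statements and proofs VERBATIM. Rung 0 — nothing here proves Schanuel, 33364, 33363, 31077 or ThinFibre 2; the class, the members and the family are HYPOTHESIS-FREE (the one external theorem used is the tree's proved `ridout_window_pow`).)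
-/

noncomputable section

namespace Summit.Schanuel.Schanuel.Theorems.RootDecomp1KThueMahler

open Polynomial LiouvilleNumber
open scoped Nat
open Summit.Schanuel.Schanuel.Theorems.RootDecomp1KTwoBaseCell (psNumer)
open Summit.Schanuel.Schanuel.Theorems.RootDecomp1KDegreeLadder
open Summit.Schanuel.Schanuel.Theorems.RootDecomp1KXLinear
open Summit.Schanuel.Schanuel.Theorems.RootDecomp1KXLinearII
open Summit.Schanuel.Schanuel.Theorems.RootDecomp1KXAll
open Summit.Schanuel.Schanuel.Theorems.RootDecomp1KLevelFinite
open Summit.Schanuel.Schanuel.Theorems.RootDecomp1KSubspaceBranch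
open Summit.Schanuel.Schanuel.Theorems.RootDecomp1KXTop
open Summit.Schanuel.Schanuel.Theorems.RootDecomp1KLocalExponent
open Summit.Schanuel.Schanuel.Theorems.RootDecomp1KIntegrality
open Summit.Schanuel.Schanuel.Theorems.RootDecomp1KHeightGrading
open Summit.Schanuel.Schanuel.Theorems.RootDecomp1KHeightMachine

/-! ## §7  THE x-LINEAR PRESENTATION TOOLKIT and the TERRITORY CERTIFICATES by TREE NAMES -/

/-- the `x`-coefficient function of `A(Y) + x·B(Y)`. -/
def linC (A B : ℤ[X]) : ℕ → ℤ[X] := fun j => if j = 0 then A else B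

/-- `linC A B 0 = A` (the constant-in-`x` coefficient of the presentation). -/
@[simp] theorem linC_zero (A B : ℤ[X]) : linC A B 0 = A := by simp [linC]
/-- `linC A B 1 = B` (the `x`-linear coefficient of the presentation). -/
@[simp] theorem linC_one (A B : ℤ[X]) : linC A B 1 = B := by simp [linC]

/-- `A(Y) + x·B(Y) = xPolyP 1 (A, B)` (tree `xPolyP_one`). -/
theorem xLinP_eq_xPolyP (A B : ℤ[X]) : xLinP A B = xPolyP 1 (linC A B) := by
  rw [xPolyP_one, linC_zero, linC_one]

/-- `xdeg (xLinP A B) = 1` for `B ≠ 0`. -/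
theorem xdeg_xLinP (A B : ℤ[X]) (hB : B ≠ 0) : xdeg (xLinP A B) = 1 := by
  rw [xLinP_eq_xPolyP]; exact xdeg_xPolyP 1 _ (by simpa using hB)

/-- `topX (xLinP A B) = B` for `B ≠ 0`. -/
theorem topX_xLinP (A B : ℤ[X]) (hB : B ≠ 0) : topX (xLinP A B) = B := by
  rw [xLinP_eq_xPolyP, topX_xPolyP 1 _ (by simpa using hB), linC_one]

/-- `xCoeff (xLinP A B) 0 = A`. -/
theorem xCoeff_xLinP_zero (A B : ℤ[X]) : xCoeff (xLinP A B) 0 = A := by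
  rw [xLinP_eq_xPolyP, xCoeff_xPolyP]; simp

/-- `xCoeff (xLinP A B) 1 = B`. -/
theorem xCoeff_xLinP_one (A B : ℤ[X]) : xCoeff (xLinP A B) 1 = B := by
  rw [xLinP_eq_xPolyP, xCoeff_xPolyP]; simp

/-- `¬ GaussAt m₀ (A + x·B)` when `deg A ≤ deg B` (node 15's dominance fails at `j = 1`). -/
theorem not_gaussAt_xLinP (A B : ℤ[X]) (hB : B ≠ 0) (hle : A.natDegree ≤ B.natDegree) (m₀ : ℕ) :
    ¬ GaussAt m₀ (xLinP A B) := by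
  rintro ⟨-, hdom, -⟩
  have := hdom 1 le_rfl (by rw [xdeg_xLinP A B hB])
  rw [xCoeff_xLinP_one, xCoeff_xLinP_zero] at this
  omega

/-- `¬ HeightDecidedAt m₀ (A + x·B)` when `m₀ ≤ deg B` (`deg_Y ≥ deg B ≥ m₀ = m₀ · xdeg`). -/
theorem not_heightDecidedAt_xLinP (A B : ℤ[X]) (hB : B ≠ 0) {m₀ : ℕ} (hm : m₀ ≤ B.natDegree) :
    ¬ HeightDecidedAt m₀ (xLinP A B) := by
  rintro ⟨-, hlt⟩
  rw [xdeg_xLinP A B hB, mul_one] at hlt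
  have := natDegree_xLinP_ge_right A B hB
  omega

/-- `¬ XLinearLt (A + x·B)` when `deg A ≤ deg B` (node 2's class is `deg B < deg A`; tree `xLinP_inj`). -/
theorem not_xLinearLt_xLinP (A B : ℤ[X]) (hle : A.natDegree ≤ B.natDegree) : ¬ XLinearLt (xLinP A B) := by
  rintro ⟨A', B', -, hlt, h⟩
  obtain ⟨rfl, rfl⟩ := xLinP_inj h
  omega

/-- in EVERY presentation `A + x·B = Σ x^j c_j` the top `c_k` has a `ℚ₂`-root if `B` has one. -/
theorem exists_padic_root_top_of_xLinP_eq (A B : ℤ[X]) (hB : B ≠ 0) {z : ℚ_[2]} (hz : aeval z B = 0)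
    (k : ℕ) (c : ℕ → ℤ[X]) (h : xLinP A B = xPolyP k c) : ∃ z : ℚ_[2], aeval z (c k) = 0 := by
  by_cases hck : c k = 0
  · exact ⟨0, by rw [hck, map_zero]⟩
  · refine ⟨z, ?_⟩
    have h1 := topX_xLinP A B hB
    rw [h, topX_xPolyP k c hck] at h1
    rw [h1]; exact hz

/-- `¬ RootlessTop e (A + x·B)` for every `e` when `B` has a `ℚ₂`-root. -/
theorem not_rootlessTop_xLinP (A B : ℤ[X]) (hB : B ≠ 0) {z : ℚ_[2]} (hz : aeval z B = 0) (e : ℕ) :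
    ¬ RootlessTop e (xLinP A B) := by
  rintro ⟨k, c, -, hroot, h⟩
  obtain ⟨z', hz'⟩ := exists_padic_root_top_of_xLinP_eq A B hB hz k c h
  exact hroot z' hz'

/-- **`¬ DecidedAt 2 (A + x·B)`** when `deg A ≤ deg B`, `deg B ≥ 2` and `B` has a `ℚ₂`-root (all five disjuncts fail). -/
theorem not_decidedAt_two_xLinP (A B : ℤ[X]) (hB : B ≠ 0) (hle : A.natDegree ≤ B.natDegree) (h2 : 2 ≤ B.natDegree)
    {z : ℚ_[2]} (hz : aeval z B = 0) : ¬ DecidedAt 2 (xLinP A B) := by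
  have hdeg := natDegree_xLinP_ge_right A B hB
  rintro (h | h | h | h | h)
  · omega
  · exact not_xLinearLt_xLinP A B hle h
  · exact absurd h.1 (by norm_num)
  · have := three_le_thinThreshold (xLinP A B); omega
  · exact not_rootlessTop_xLinP A B hB hz 1 h

/-- node 14's ROOT CONDITION at `m₀ ≤ 2` FAILS for a `B ≠ 0` with a `ℚ₂`-root and no rational root
((i) the root is in `ℚ₂`; (ii) it is irrational; (iii) `2μ + 1 ≥ 3 > 2`). -/
theorem not_rootCond_of_padic_root (B : ℤ[X]) (hB : B ≠ 0) {z : ℚ_[2]} (hz : aeval z B = 0)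
    (hirr : ∀ q : ℚ, aeval q B ≠ 0) {m₀ : ℕ} (hm : m₀ ≤ 2) : ¬ RootCond m₀ B := by
  intro hR
  have hβroot : aeval (algebraMap ℚ_[2] (PadicAlgCl 2) z) B = 0 := by
    rw [← algebraMap_aeval_padic, hz, map_zero]
  rcases hR _ hβroot with hi | ⟨q, hq, -⟩ | hiii
  · exact hi z rfl
  · apply hirr q
    have h1 : aeval (q : PadicAlgCl 2) B = 0 := by rw [hq]; exact hβroot
    have h2 : ((aeval q B : ℚ) : PadicAlgCl 2) = 0 := by rw [aeval_ratCast]; exact h1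
    exact_mod_cast h2
  · have hm0 : B.map (algebraMap ℤ (PadicAlgCl 2)) ≠ 0 :=
      (Polynomial.map_ne_zero_iff (algebraMap ℤ (PadicAlgCl 2)).injective_int).mpr hB
    have h1 : 0 < rootMult B (algebraMap ℚ_[2] (PadicAlgCl 2) z) := by
      unfold rootMult
      rw [rootMultiplicity_pos hm0, IsRoot.def, eval_map_algebraMap]
      exact hβroot
    omega

/-- **`¬ LocalAt m₀ (A + x·B)` for `m₀ ≤ 2`** when `B ≠ 0` has a `ℚ₂`-root and no rational root (tree `localAt_iff`/`topX`). -/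
theorem not_localAt_xLinP (A B : ℤ[X]) (hB : B ≠ 0) {z : ℚ_[2]} (hz : aeval z B = 0) (hirr : ∀ q : ℚ, aeval q B ≠ 0)
    {m₀ : ℕ} (hm : m₀ ≤ 2) : ¬ LocalAt m₀ (xLinP A B) := fun h => by
  have hR := rootCond_topX_of_localAt h
  rw [topX_xLinP A B hB] at hR
  exact not_rootCond_of_padic_root B hB hz hirr hm hR

/-- node 10's conjugate-poles shape curve IS x-linear: `normShapeCurve g q a D = (−g) + x·(D·q^a)`. -/
theorem normShapeCurve_eq_xLinP (g q : ℤ[X]) (a : ℕ) (D : ℤ) : normShapeCurve g q a D = xLinP (-g) (C D * q ^ a) := by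
  simp only [normShapeCurve, xLinP, Polynomial.map_neg, Polynomial.map_mul, Polynomial.map_pow, Polynomial.map_C,
    Polynomial.C_mul]
  ring

/-- … so an x-linear curve of norm shape has `deg B = a · deg q` (`= 2a` under `NormShapeHyp`). -/
theorem natDegree_of_xLinP_eq_normShapeCurve {A B g q : ℤ[X]} {a : ℕ} {D : ℤ} (hD : D ≠ 0)
    (h : xLinP A B = normShapeCurve g q a D) : B.natDegree = a * q.natDegree := by
  rw [normShapeCurve_eq_xLinP] at h
  obtain ⟨-, rfl⟩ := xLinP_inj h
  rw [natDegree_C_mul hD, natDegree_pow]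

/-- **NOT OF NORM SHAPE**: an x-linear curve with `deg B` ODD is no `normShapeCurve g q a D` with `NormShapeHyp` (`deg B = 2a`). -/
theorem xLinP_ne_normShapeCurve_of_odd {A B : ℤ[X]} (hodd : Odd B.natDegree) (g q : ℤ[X]) (a : ℕ) (D : ℤ)
    (hH : NormShapeHyp g q a D) : xLinP A B ≠ normShapeCurve g q a D := fun h => by
  have h1 := natDegree_of_xLinP_eq_normShapeCurve hH.2.2.2.2.2 h
  rw [hH.1] at h1
  exact (Nat.not_even_iff_odd.mpr hodd) ⟨a, by omega⟩

end Summit.Schanuel.Schanuel.Theorems.RootDecomp1KThueMahler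

end
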